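/-
Copyright (c) 2026 the pub-hodgecm-mathlib formalisation cell (harness21).  Prover seat hodgecm-mathlib-K2Liu-p05 (g7): Track B «K2-LIT»,
hLiu418 = stmt-HodgeConjecture-24832; LEAD F0P6-plan (g14) BATCH #53 (2) ∕ #54 (1) «(E4) GK SPHERICAL VALUE n = 2, β = 0», cut (F-GK-3) (K2E5-p16 (g8) 16:28:52Z;
K2E5-plan (g7) TABLE FLAG 16:38:29Z «(F-GK-3) → K2Liu-p05 (g7)»).
-/
import Summits.HodgeConjecture.HodgeConjecture.Theorems.K2LiuSiegelCocycleSphericalValue      -- ★ (F-GK-2) p862057: the value modulo the four unit scalars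
import Literature.NumberTheory.GelbartRogawski1991.LocalDoubledUnitaryGoodPlace              -- ★ `IsGoodPlace`, `valuation_eq_one_iff_valued`
import HarnessLib

/-!
# Crux `HLiu418`, road `K2_Liu`, #41 KIND 0 (β) Euler face, brick (E4) «GK spherical value», file (F-GK-3):
# THE FOUR UNIT SCALARS OF THE COCYCLE ARE `1` AT A GOOD PLACE — `χ_s(m₀) = C₁ = C₂ = C₃ = 1`

Cell `hodgecm-mathlib`, crux item hLiu418 = `stmt-HodgeConjecture-24832`; squad K2 ∕ K2Liu; prover K2Liu-p05 (g7) ((F-GK-3) hand; lead hand of (E4) and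
(F-GK-4) consumer K2E5-p16 (g8); desk K2Liu-p13 (g4); books K2E5-plan (g7)).  THEOREMS ONLY (no `def`, no instance, no notation, no named-fact hypothesis,
no `sorry`); lane `--supports stmt-HodgeConjecture-24832 --as helper` (count-neutral helper).  ONE FRAME (RULING M-156o (c)): `φ := frameConj Q ∘ toLocalFour`
(★ B1b-1, K2Liu-p03 (g6)); the adapted-frame data `(D, Dinv, Q)` are hypotheses, as in ★ B7 and ★ (F-GK-2).

THE POINT.  ★ (F-GK-2) `K2LiuSiegelCocycleSphericalValue.localIntertwining_eq_aNorm_mul_of_spherical_of_forall_eq` evaluates the Siegel intertwining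
operator of `U(2,2)(F_v)` on a `K₀`-spherical section as `aNorm 2 χ_v (νN(BOX)) s · f(h)` PROVIDED the four unit scalars of the cocycle are `1`:
`χ_s(m₀)` (`m₀ = w_Δ · φ(w_Δ^J) ∈ M_Δ(F_v)`, Δ-block `D_v`, ★ `adapt_matA_weylDelta_mul_frameConj_weylSiegel`), `C₁ = χ_s(φ t(1, −δ⁻¹))`, `C₂ = χ_w(−1)`,
`C₃ = χ_s(φ t(−δ⁻¹, 1)) · ∏_w ‖δ_w‖`.  Each is the inducing character `χ_v(det_Δ ·)|det_Δ ·|_v^{s+1}` (★ D1 `localSiegelCharacter`) at a LEVI element whose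
Δ-determinant is a `w`-adic UNIT at every `w ∣ v` — `(−δ⁻¹)_w`, `−1`, `(det D)_w` — so at a GOOD place (`χ_w` unramified, `δ` a `w`-unit: the fields `.chi`, `.delta`
of ★ Lit `LocalSplitting.IsGoodPlace`) and for a `v`-INTEGRAL frame (`D`, `D⁻¹` integral at every `w ∣ v`, hence `det D` a unit) all four are `1`.
* §1 `localSiegelCharacter_eq_one_of_valuation_detDelta_eq_one` (generic rank `n`): `χ_w` unramified at every `w ∣ v` and `|det_Δ(u)_w|_w = 1` at every `w ∣ v`
  ⇒ `χ_s(u) = 1`.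
* §2 the four scalars, each concluding the corresponding binder of ★ (F-GK-2) §3 BYTE FOR BYTE: `chi_neg_one_eq_one` (`hC₂`),
  `localSiegelCharacter_torusElt_one_negInvDelta_eq_one` (`hC₁`), `localSiegelCharacter_torusElt_negInvDelta_one_mul_prod_norm_eq_one` (`hC₃`),
  `localSiegelCharacter_weylDelta_mul_frameConj_weylSiegel_eq_one` (`hm₀`, from `|det D|_w = 1`) and `valuation_det_eq_one_of_integral` (`D`, `D⁻¹` integral ⇒ `|det D|_w = 1`).
* §3 **`localIntertwining_eq_aNorm_mul_of_spherical_of_isGoodPlace`** — ★ (F-GK-2) §3 with the four scalar binders DISCHARGED from «`χ_w` unramified, `δ` a `w`-unit,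
  `D`, `D⁻¹` integral at every `w ∣ v`» (the open subgroup `K₀`, its five letter binders and the box are untouched; `K₀ := H(𝒪_v)` is the sequel
  `K2LiuSiegelCocycleSphericalLocalInt`).
HONEST LABEL.  `HC_CM` is proved only modulo the 7 printed citations (2 remaining named inputs: hLiu418 = `stmt-HodgeConjecture-24832`,
h413 = `stmt-HodgeConjecture-24833`) until rung 0 closes.

## References
* [Casselman1980] W. Casselman, *The unramified principal series of p-adic groups I*, Compositio Math. 40 (1980), §3 Thm. 3.1 (the unramified character is
  trivial on `M(𝒪)`; `c_w(χ)` at the spherical vector).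
* [HarrisKudlaSweet1996] M. Harris, S. Kudla, W. J. Sweet, J. AMS 9 (1996), §1 (1.15), §6 (6.14)–(6.16).
* [KudlaSweet1997] S. Kudla, W. J. Sweet, *Degenerate principal series representations for U(n,n)*, Israel J. Math. 98 (1997), §1.
* [GelbartRogawski1991] S. Gelbart, J. Rogawski, Invent. Math. 105 (1991), §3.1 (3.1.3) (the good places of the doubled unitary datum).
* [CasselsFrohlichANT1967] J. W. S. Cassels, A. Fröhlich (eds.), *Algebraic Number Theory* (1967), Ch. II §10–§11.
-/

set_option autoImplicit false
set_option linter.dupNamespace false -- the mandated namespace repeats `HodgeConjecture.HodgeConjecture`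

noncomputable section

open scoped Classical NNReal ENNReal
open NumberField IsDedekindDomain Matrix MeasureTheory Topology
open Literature.NumberTheory.GaloisRepresentations.IsNonarchimedeanLocalField
open Literature.NumberTheory.Automorphic Literature.NumberTheory.Automorphic.UnitaryGroup
open Literature.NumberTheory.GelbartRogawski1991.AdaptedBlocks
open Literature.NumberTheory.GelbartRogawski1991.UnitaryDualPair.LocalSplitting
open Literature.NumberTheory.K2Lit.LocalSiegelDoubled
open Summit.HodgeConjecture.HodgeConjecture.Cruxes.HLiu418.K2LiuQRationalDefs
open Summit.HodgeConjecture.HodgeConjecture.Cruxes.HLiu418.K2LiuLocalLFactorDefs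
open Summit.HodgeConjecture.HodgeConjecture.Cruxes.HLiu418.K2LiuLocalSiegelIwasawaFrame
open Summit.HodgeConjecture.HodgeConjecture.Cruxes.HLiu418.K2LiuLocalSiegelIwasawa
open Summit.HodgeConjecture.HodgeConjecture.Cruxes.HLiu418.K2LiuDoubledUTwoTwoBorelFrame
open Summit.HodgeConjecture.HodgeConjecture.Cruxes.HLiu418.K2LiuDoubledUTwoTwoWeylCocycle
open Summit.HodgeConjecture.HodgeConjecture.Cruxes.HLiu418.K2LiuDoubledUTwoTwoLevi
open Summit.HodgeConjecture.HodgeConjecture.Cruxes.HLiu418.K2LiuDoubledUTwoTwoFrameTransport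
open Summit.HodgeConjecture.HodgeConjecture.Cruxes.HLiu418.K2LiuDoubledUTwoTwoLeviTransport
open Summit.HodgeConjecture.HodgeConjecture.Cruxes.HLiu418.K2LiuSiegelLeviWeylAlgebra
open Summit.HodgeConjecture.HodgeConjecture.Cruxes.HLiu418.K2LiuUnipDeltaRankOneCoordinates
open Summit.HodgeConjecture.HodgeConjecture.Cruxes.HLiu418.K2LiuSiegelCocycleLetters
open Summit.HodgeConjecture.HodgeConjecture.Cruxes.HLiu418.K2LiuSiegelIntertwiningCocycle
open Summit.HodgeConjecture.HodgeConjecture.Cruxes.HLiu418.K2LiuSiegelCocycleSphericalValue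

namespace Summit.HodgeConjecture.HodgeConjecture.Cruxes.HLiu418.K2LiuSiegelCocycleSphericalValueNormalised

/-! ## §1 The inducing character is `1` at a Levi element with unit Δ-determinants (generic rank `n`) -/

section Generic

variable (F : Type) [Field F] [NumberField F] (E : Type) [Field E] [NumberField E] [Algebra F E] (c : E ≃ₐ[F] E)
  (v : HeightOneSpectrum (𝓞 F)) (n : ℕ) {JD : Matrix (Fin (n + n)) (Fin (n + n)) E}

/-- **`χ_s(u) = 1` when every `χ_w` is unramified and every `det_Δ(u)_w` is a `w`-adic unit**: `χ_w(det_Δ u_w) = 1` by unramifiedness and `‖det_Δ u_w‖_w = 1`, so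
`χ_v(det_Δ u) · |det_Δ u|_v^{s + n/2} = 1 · 1^{s + n/2} = 1`. [cite: Casselman1980, §3 Thm. 3.1] [cite: HarrisKudlaSweet1996, §1 (1.15)] -/
theorem localSiegelCharacter_eq_one_of_valuation_detDelta_eq_one (χv : ∀ w : PlacesOver E v, (w.1.adicCompletion E)ˣ →* ℂˣ)
    (hχ : ∀ (w : PlacesOver E v) (u : (w.1.adicCompletion E)ˣ), ValuativeRel.valuation (w.1.adicCompletion E) (u : w.1.adicCompletion E) = 1 → χv w u = 1)
    (s : ℂ) {u : UnitaryGroup.localPi E c (n + n) JD v}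
    (hu : ∀ w : PlacesOver E v, ValuativeRel.valuation (w.1.adicCompletion E) (detDelta F E c v n w u) = 1) :
    localSiegelCharacter F E c v n χv s u = 1 := by
  have hunit : ∀ w : PlacesOver E v, IsUnit (detDelta F E c v n w u) := fun w => by
    refine isUnit_iff_ne_zero.2 fun h0 => ?_
    have h := hu w
    rw [h0, map_zero] at h
    exact zero_ne_one h
  have h1 : ((chiDet F E c v n χv u : ℂˣ) : ℂ) = 1 := by
    unfold chiDet
    rw [Finset.prod_eq_one fun w _ => ?_, Units.val_one]
    rw [dif_pos (hunit w)]
    exact hχ w _ (by rw [IsUnit.unit_spec]; exact hu w)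
  have h2 : absDetDelta F E c v n u = 1 := by
    unfold absDetDelta
    refine Finset.prod_eq_one fun w _ => ?_
    have h := hu w
    rw [valuation_eq_one_iff_valued] at h
    rw [NumberField.FinitePlace.norm_def, h, map_one, NNReal.coe_one]
  unfold localSiegelCharacter
  rw [h1, h2, Complex.ofReal_one, Complex.one_cpow, mul_one]

omit [NumberField F] in
/-- an unramified `χ_w` is trivial on `−1`. [cite: Casselman1980, §3] -/
theorem chi_neg_one_eq_one (χv : ∀ w : PlacesOver E v, (w.1.adicCompletion E)ˣ →* ℂˣ)
    (hχ : ∀ (w : PlacesOver E v) (u : (w.1.adicCompletion E)ˣ), ValuativeRel.valuation (w.1.adicCompletion E) (u : w.1.adicCompletion E) = 1 → χv w u = 1)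
    (w : PlacesOver E v) : ((χv w (-1) : ℂˣ) : ℂ) = 1 := by
  rw [hχ w (-1) (by rw [Units.val_neg, Units.val_one, Valuation.map_neg, map_one]), Units.val_one]

/-- **`D`, `D⁻¹` integral at `w` ⇒ `det D` is a `w`-adic unit** (`|det D|_w ≤ 1`, `|det D⁻¹|_w ≤ 1`, `det D · det D⁻¹ = 1`; `2 × 2`).
[cite: CasselsFrohlichANT1967, Ch. II §10] -/
theorem valuation_det_eq_one_of_integral {D Dinv : Matrix (Fin 2) (Fin 2) F} (hDD : D * Dinv = 1)
    (hDw : ∀ (w : PlacesOver E v) (i j : Fin 2), ValuativeRel.valuation (w.1.adicCompletion E) (algebraMap E (w.1.adicCompletion E) (algebraMap F E (D i j))) ≤ 1)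
    (hDiw : ∀ (w : PlacesOver E v) (i j : Fin 2), ValuativeRel.valuation (w.1.adicCompletion E) (algebraMap E (w.1.adicCompletion E) (algebraMap F E (Dinv i j))) ≤ 1)
    (w : PlacesOver E v) :
    ValuativeRel.valuation (w.1.adicCompletion E) (algebraMap E (w.1.adicCompletion E) (algebraMap F E D.det)) = 1 := by
  -- `ψ : F → E_w`, the valuation of a `2 × 2` determinant with integral entries is `≤ 1`
  have hle : ∀ {M : Matrix (Fin 2) (Fin 2) F},
      (∀ i j : Fin 2, ValuativeRel.valuation (w.1.adicCompletion E) (algebraMap E (w.1.adicCompletion E) (algebraMap F E (M i j))) ≤ 1) →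
      ValuativeRel.valuation (w.1.adicCompletion E) (algebraMap E (w.1.adicCompletion E) (algebraMap F E M.det)) ≤ 1 := by
    intro M hM
    rw [Matrix.det_fin_two, map_sub, map_sub, map_mul, map_mul, map_mul, map_mul]
    refine le_trans (Valuation.map_sub _ _ _) (max_le ?_ ?_)
    · rw [map_mul]; exact mul_le_one' (hM 0 0) (hM 1 1)
    · rw [map_mul]; exact mul_le_one' (hM 0 1) (hM 1 0)
  have hD := hle (hDw w)
  have hDi := hle (hDiw w)
  have hprod : ValuativeRel.valuation (w.1.adicCompletion E) (algebraMap E (w.1.adicCompletion E) (algebraMap F E D.det)) *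
      ValuativeRel.valuation (w.1.adicCompletion E) (algebraMap E (w.1.adicCompletion E) (algebraMap F E Dinv.det)) = 1 := by
    rw [← map_mul, ← map_mul, ← map_mul, ← Matrix.det_mul, hDD, Matrix.det_one, map_one, map_one, map_one]
  refine le_antisymm hD ?_
  calc (1 : ValuativeRel.ValueGroupWithZero (w.1.adicCompletion E))
        = ValuativeRel.valuation (w.1.adicCompletion E) (algebraMap E (w.1.adicCompletion E) (algebraMap F E D.det)) *
            ValuativeRel.valuation (w.1.adicCompletion E) (algebraMap E (w.1.adicCompletion E) (algebraMap F E Dinv.det)) := hprod.symm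
    _ ≤ ValuativeRel.valuation (w.1.adicCompletion E) (algebraMap E (w.1.adicCompletion E) (algebraMap F E D.det)) * 1 := mul_le_mul' le_rfl hDi
    _ = _ := mul_one _

end Generic

/-! ## §2 The four unit scalars of the cocycle in the ONE FRAME of ★ B7 ∕ ★ (F-GK-2) -/

section Frame

variable (F : Type) [Field F] [NumberField F] (E : Type) [Field E] [NumberField E] [Algebra F E]
  [Algebra.IsQuadraticExtension F E] (c : E ≃ₐ[F] E)
  {δ : E} (hcδ : c δ = -δ) (hδ : δ ≠ 0) {d : F} (hd : δ * δ = algebraMap F E d) (v : HeightOneSpectrum (𝓞 F))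
  {T₂ : Matrix (Fin 2) (Fin 2) F} (hT₂ : T₂.IsSymm) {J₂D : Matrix (Fin (2 + 2)) (Fin (2 + 2)) E} (hJ₂D : J₂D = (gramD F 2 T₂).map (algebraMap F E))
  (D Dinv : Matrix (Fin 2) (Fin 2) F) (hDD : D * Dinv = 1) (hDD' : Dinv * D = 1) (Q : GL (Fin (2 + 2)) F)
  (hQm : (Q : Matrix (Fin (2 + 2)) (Fin (2 + 2)) F) = Matrix.reindex (e₂ 2) (e₂ 2) (Matrix.fromBlocks 1 D 1 (-D)))
  (hQ : (Q : Matrix (Fin (2 + 2)) (Fin (2 + 2)) F)ᵀ * gramD F 2 T₂ * (Q : Matrix (Fin (2 + 2)) (Fin (2 + 2)) F) = (StdForm.antidiagonal (2 + 2)).over F)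
  (χv : ∀ w : PlacesOver E v, (w.1.adicCompletion E)ˣ →* ℂˣ)
  (hχ : ∀ (w : PlacesOver E v) (u : (w.1.adicCompletion E)ˣ), ValuativeRel.valuation (w.1.adicCompletion E) (u : w.1.adicCompletion E) = 1 → χv w u = 1)
  (hδv : ∀ w : PlacesOver E v, ValuativeRel.valuation (w.1.adicCompletion E) (algebraMap E (w.1.adicCompletion E) δ) = 1)

omit [NumberField F] [Algebra.IsQuadraticExtension F E] in
include hδv in
/-- the `w`-component of the unit `−δ⁻¹` of `E ⊗ F_v` is a `w`-adic unit when `δ` is. [cite: CasselsFrohlichANT1967, Ch. II §10–§11] -/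
theorem valuation_negInvDelta_apply (w : PlacesOver E v) :
    ValuativeRel.valuation (w.1.adicCompletion E)
        (((-((Units.mk0 δ hδ).map (algebraMap E (UnitaryGroup.LocalRing E v) : E →* UnitaryGroup.LocalRing E v))⁻¹ : (UnitaryGroup.LocalRing E v)ˣ) :
          UnitaryGroup.LocalRing E v) w) = 1 := by
  rw [Units.val_neg, Pi.neg_apply, Valuation.map_neg, Units.val_inv_eq_inv_val, Pi.inv_apply, map_inv₀, Units.coe_map, MonoidHom.coe_coe,
    Units.val_mk0, Pi.algebraMap_apply, hδv w, inv_one]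

omit [Algebra.IsQuadraticExtension F E] in
include hδv in
/-- `∏_w ‖δ_w‖ = 1` when `δ` is a unit at every `w ∣ v`. [cite: CasselsFrohlichANT1967, Ch. II §10–§11] -/
theorem prod_norm_delta_eq_one :
    ((∏ w' : PlacesOver E v, ‖algebraMap E (UnitaryGroup.LocalRing E v) δ w'‖ : ℝ) : ℂ) = 1 := by
  rw [Finset.prod_eq_one fun w' _ => ?_, Complex.ofReal_one]
  have h := hδv w'
  rw [valuation_eq_one_iff_valued] at h
  rw [Pi.algebraMap_apply, NumberField.FinitePlace.norm_def, h, map_one, NNReal.coe_one]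

include hJ₂D hDD hQm hχ hδv in
/-- **`C₁ = χ_s(φ t(1, −δ⁻¹)) = 1`** at a good place (`det_Δ(φ t(a,b))_w = a_w b_w`, ★ `detDelta_frameConj_torusElt`) — the `hC₁` binder of ★ (F-GK-2) §3.
[cite: Casselman1980, §3 Thm. 3.1] [cite: HarrisKudlaSweet1996, §1 (1.15), §6 (6.14)] -/
theorem localSiegelCharacter_torusElt_one_negInvDelta_eq_one (s : ℂ) :
    localSiegelCharacter F E c v 2 χv s (FrameTransport.frameConj F E c v (2 + 2) hJ₂D (antidiagonal_over_eq_map F E 2) Q hQ (toLocalFour F E c v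
        (torusElt (UnitaryGroup.LocalRing E v) (UnitaryGroup.conjLocal E c v) (UnitaryGroup.conjLocal_conjLocal c v hcδ hδ) (1)
          (-((Units.mk0 δ hδ).map (algebraMap E (UnitaryGroup.LocalRing E v) : E →* UnitaryGroup.LocalRing E v))⁻¹)))) = 1 :=
  localSiegelCharacter_eq_one_of_valuation_detDelta_eq_one F E c v 2 χv hχ s fun w => by
    rw [detDelta_frameConj_torusElt F E c hcδ hδ v hJ₂D D Dinv hDD Q hQm hQ, Units.val_one, Pi.one_apply, one_mul]
    exact valuation_negInvDelta_apply F E hδ v hδv w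

include hJ₂D hDD hQm hχ hδv in
/-- **`C₃ = χ_s(φ t(−δ⁻¹, 1)) · ∏_w ‖δ_w‖ = 1`** at a good place — the `hC₃` binder of ★ (F-GK-2) §3. [cite: Casselman1980, §3 Thm. 3.1] [cite: HarrisKudlaSweet1996, §6 (6.16)] -/
theorem localSiegelCharacter_torusElt_negInvDelta_one_mul_prod_norm_eq_one (s : ℂ) :
    localSiegelCharacter F E c v 2 χv s (FrameTransport.frameConj F E c v (2 + 2) hJ₂D (antidiagonal_over_eq_map F E 2) Q hQ (toLocalFour F E c v
          (torusElt (UnitaryGroup.LocalRing E v) (UnitaryGroup.conjLocal E c v) (UnitaryGroup.conjLocal_conjLocal c v hcδ hδ)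
            (-((Units.mk0 δ hδ).map (algebraMap E (UnitaryGroup.LocalRing E v) : E →* UnitaryGroup.LocalRing E v))⁻¹) (1)))) *
        ((∏ w' : PlacesOver E v, ‖algebraMap E (UnitaryGroup.LocalRing E v) δ w'‖ : ℝ) : ℂ) = 1 := by
  rw [prod_norm_delta_eq_one F E v hδv, mul_one]
  exact localSiegelCharacter_eq_one_of_valuation_detDelta_eq_one F E c v 2 χv hχ s fun w => by
    rw [detDelta_frameConj_torusElt F E c hcδ hδ v hJ₂D D Dinv hDD Q hQm hQ, Units.val_one, Pi.one_apply, mul_one]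
    exact valuation_negInvDelta_apply F E hδ v hδv w

omit [Algebra.IsQuadraticExtension F E] in
include hJ₂D hDD hQm in
/-- **the Δ-determinant of `m₀ = w_Δ · φ(w_Δ^J)` is `(det D)_w`** (its adapted matrix is `diag(D_v, D⁻¹_v)`, ★ `adapt_matA_weylDelta_mul_frameConj_weylSiegel`; ★ `detDelta_levi`).
[cite: HarrisKudlaSweet1996, §1 (1.12), (1.15)] -/
theorem detDelta_weylDelta_mul_frameConj_weylSiegel (w : PlacesOver E v) :
    detDelta F E c v 2 w (weylDelta F E c v 2 hJ₂D (T₀ := T₂) * FrameTransport.frameConj F E c v (2 + 2) hJ₂D (antidiagonal_over_eq_map F E 2) Q hQ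
        (toLocalFour F E c v (weylSiegel (UnitaryGroup.LocalRing E v) (UnitaryGroup.conjLocal E c v)))) =
      algebraMap E (w.1.adicCompletion E) (algebraMap F E D.det) := by
  have hadapt := adapt_matA_weylDelta_mul_frameConj_weylSiegel F E c v hJ₂D D Dinv hDD Q hQm hQ
  rw [adapt_eq] at hadapt
  obtain ⟨hA, -, hC, -⟩ := Matrix.fromBlocks_inj.1 hadapt
  rw [detDelta_levi F E c v 2 hC w, hA, ← RingHom.mapMatrix_apply, ← RingHom.map_det, RingHom.comp_apply, toLocalRing_apply]
  exact toPlace_coe v w D.det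

omit [Algebra.IsQuadraticExtension F E] in
include hJ₂D hDD hQm hχ in
/-- **`χ_s(m₀) = 1`** for `m₀ = w_Δ · φ(w_Δ^J)` when `χ_v` is unramified and `det D` is a unit at every `w ∣ v` — the `hm₀` binder of ★ (F-GK-2) §3.
[cite: Casselman1980, §3 Thm. 3.1] [cite: HarrisKudlaSweet1996, §1 (1.12)] -/
theorem localSiegelCharacter_weylDelta_mul_frameConj_weylSiegel_eq_one
    (hDdet : ∀ w : PlacesOver E v, ValuativeRel.valuation (w.1.adicCompletion E) (algebraMap E (w.1.adicCompletion E) (algebraMap F E D.det)) = 1) (s : ℂ) :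
    localSiegelCharacter F E c v 2 χv s (weylDelta F E c v 2 hJ₂D (T₀ := T₂) * FrameTransport.frameConj F E c v (2 + 2) hJ₂D (antidiagonal_over_eq_map F E 2) Q hQ
        (toLocalFour F E c v (weylSiegel (UnitaryGroup.LocalRing E v) (UnitaryGroup.conjLocal E c v)))) = 1 :=
  localSiegelCharacter_eq_one_of_valuation_detDelta_eq_one F E c v 2 χv hχ s fun w => by
    rw [detDelta_weylDelta_mul_frameConj_weylSiegel F E c v hJ₂D D Dinv hDD Q hQm hQ w]
    exact hDdet w

/-! ## §3 The Gindikin–Karpelevich value with the unit scalars discharged -/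

include hDD hDD' hQm hχ hδv in
set_option maxHeartbeats 400000 in -- as ★ (F-GK-2) §3 (the binder telescope of the chain; `whnf` > 200 000)
/-- **THE SIEGEL INTERTWINING OPERATOR ON A `K₀`-SPHERICAL SECTION AT A GOOD PLACE.**  ★ (F-GK-2) `localIntertwining_eq_aNorm_mul_of_spherical_of_forall_eq` with its
four unit-scalar binders `hm₀ hC₁ hC₂ hC₃` DISCHARGED: if every `χ_w` (`w ∣ v`) is unramified, `δ` is a unit at every `w ∣ v` and the frame `D`, `D⁻¹` is integral at every
`w ∣ v`, then for `1 < re s`, `f ∈ I_v(s, χ_v)` smooth and right-`K₀`-invariant (`K₀` open, containing the cocycle's letters at integral points) and `h ∈ K₀`: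
`M_v(s) f (h) = aNorm 2 χ_v (νN(BOX)) s · f(h) = νN(BOX) · L_F(2s+1)L_{E_w}(2s)L_F(2s−1) ∕ (L_F(2s+2)L_{E_w}(2s+1)L_F(2s)) · f(h)` (non-split place, ONE FRAME).
[cite: Casselman1980, §3 Thm. 3.1] [cite: KudlaSweet1997, §1] [cite: HarrisKudlaSweet1996, §6 (6.14)–(6.16)] -/
theorem localIntertwining_eq_aNorm_mul_of_spherical_of_isGoodPlace
    [MeasurableSpace (unipDeltaLocal F E c v 2 (JD := J₂D))] [BorelSpace (unipDeltaLocal F E c v 2 (JD := J₂D))]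
    (νN : Measure (unipDeltaLocal F E c v 2 (JD := J₂D))) [νN.IsHaarMeasure]
    (hχu : ∀ (w' : PlacesOver E v) (x : (w'.1.adicCompletion E)ˣ), ‖((χv w' x : ℂˣ) : ℂ)‖ = 1)
    (hDw : ∀ (w : PlacesOver E v) (i j : Fin 2), ValuativeRel.valuation (w.1.adicCompletion E) (algebraMap E (w.1.adicCompletion E) (algebraMap F E (D i j))) ≤ 1)
    (hDiw : ∀ (w : PlacesOver E v) (i j : Fin 2), ValuativeRel.valuation (w.1.adicCompletion E) (algebraMap E (w.1.adicCompletion E) (algebraMap F E (Dinv i j))) ≤ 1)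
    (K₀ : Subgroup (UnitaryGroup.localPi E c (2 + 2) J₂D v)) (hK₀ : IsOpen (K₀ : Set (UnitaryGroup.localPi E c (2 + 2) J₂D v)))
    {s : ℂ} (hs : 1 < s.re) {f : UnitaryGroup.localPi E c (2 + 2) J₂D v → ℂ} (hSieg : IsLocalSiegelSection F E c hcδ hδ hd v 2 hT₂ hJ₂D χv s f) (hsm : IsSmooth F E c v 2 f)
    (hfK : ∀ g, ∀ k ∈ K₀, f (g * k) = f g)
    (w : PlacesOver E v) (hw : ∀ w' : PlacesOver E v, w' = w)
    (A : GL (Fin 2) (UnitaryGroup.LocalRing E v)) (hA : A.val = !![1 - Pi.single w 1, Pi.single w 1; Pi.single w 1, 1 - Pi.single w 1])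
    (hKw₂ : FrameTransport.frameConj F E c v (2 + 2) hJ₂D (antidiagonal_over_eq_map F E 2) Q hQ (toLocalFour F E c v (weylTwo (UnitaryGroup.LocalRing E v) (UnitaryGroup.conjLocal E c v))) ∈ K₀) (hKA : FrameTransport.frameConj F E c v (2 + 2) hJ₂D (antidiagonal_over_eq_map F E 2) Q hQ (toLocalFour F E c v (leviElt (UnitaryGroup.LocalRing E v) (UnitaryGroup.conjLocal E c v) (UnitaryGroup.conjLocal_conjLocal c v hcδ hδ) A)) ∈ K₀)
    (hKu : ∀ t ∈ primePowBall (v.adicCompletion F) 0, FrameTransport.frameConj F E c v (2 + 2) hJ₂D (antidiagonal_over_eq_map F E 2) Q hQ (toLocalFour F E c v (uLongTwo (UnitaryGroup.LocalRing E v) (UnitaryGroup.conjLocal E c v) (UnitaryGroup.toLocalRing E v t * algebraMap E (UnitaryGroup.LocalRing E v) δ) (conjLocal_coord F E c hcδ v t))) ∈ K₀)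
    (hKū : ∀ t ∈ primePowBall (v.adicCompletion F) 0, FrameTransport.frameConj F E c v (2 + 2) hJ₂D (antidiagonal_over_eq_map F E 2) Q hQ (toLocalFour F E c v (uLongTwo (UnitaryGroup.LocalRing E v) (UnitaryGroup.conjLocal E c v) (UnitaryGroup.toLocalRing E v t * algebraMap E (UnitaryGroup.LocalRing E v) δ⁻¹) (conjLocal_coord_inv F E c hcδ v t))) ∈ K₀)
    (hKm : ∀ ζ ∈ primePowBall (w.1.adicCompletion E) 0, FrameTransport.frameConj F E c v (2 + 2) hJ₂D (antidiagonal_over_eq_map F E 2) Q hQ (toLocalFour F E c v (uMinus (UnitaryGroup.LocalRing E v) (UnitaryGroup.conjLocal E c v) (UnitaryGroup.conjLocal_conjLocal c v hcδ hδ) (Pi.single w ζ))) ∈ K₀)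
    (h : UnitaryGroup.localPi E c (2 + 2) J₂D v) (hh : h ∈ K₀) :
    localIntertwining F E c v 2 hJ₂D νN f h = aNorm F E c v 2 χv (νN.real {u : unipDeltaLocal F E c v 2 (JD := J₂D) | ∃ b₁ ∈ primePowBall (v.adicCompletion F) 0, ∃ ζ ∈ primePowBall (w.1.adicCompletion E) 0, ∃ b₂ ∈ primePowBall (v.adicCompletion F) 0, (u : UnitaryGroup.localPi E c (2 + 2) J₂D v) = FrameTransport.frameConj F E c v (2 + 2) hJ₂D (antidiagonal_over_eq_map F E 2) Q hQ (toLocalFour F E c v (nSiegel (UnitaryGroup.LocalRing E v) (UnitaryGroup.conjLocal E c v) (UnitaryGroup.conjLocal_conjLocal c v hcδ hδ) (UnitaryGroup.toLocalRing E v b₁ * algebraMap E (UnitaryGroup.LocalRing E v) δ) (Pi.single w ζ) (UnitaryGroup.toLocalRing E v b₂ * algebraMap E (UnitaryGroup.LocalRing E v) δ) (conjLocal_coord F E c hcδ v b₁) (conjLocal_coord F E c hcδ v b₂)))}) s * f h :=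
  localIntertwining_eq_aNorm_mul_of_spherical_of_forall_eq F E c hcδ hδ hd v hT₂ hJ₂D D Dinv hDD hDD' Q hQm hQ νN χv hχu K₀ hK₀ hs hSieg hsm hfK w hw A hA
    hKw₂ hKA hKu hKū hKm
    (localSiegelCharacter_weylDelta_mul_frameConj_weylSiegel_eq_one F E c v hJ₂D D Dinv hDD Q hQm hQ χv hχ (valuation_det_eq_one_of_integral F E v hDD hDw hDiw) s)
    (localSiegelCharacter_torusElt_one_negInvDelta_eq_one F E c hcδ hδ v hJ₂D D Dinv hDD Q hQm hQ χv hχ hδv s)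
    (chi_neg_one_eq_one F E v χv hχ w)
    (localSiegelCharacter_torusElt_negInvDelta_one_mul_prod_norm_eq_one F E c hcδ hδ v hJ₂D D Dinv hDD Q hQm hQ χv hχ hδv s) h hh

end Frame

end Summit.HodgeConjecture.HodgeConjecture.Cruxes.HLiu418.K2LiuSiegelCocycleSphericalValueNormalised

end
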